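/-
Copyright (c) 2026 the pub-hodgecm-mathlib formalisation cell (harness21).  Prover seat hodgecm-mathlib-LH4-p18 (g0), req620 Track A «(D-RAM) FOUR-FRAME» squad, helper lane on
h413 = stmt-HodgeConjecture-24833 (count-neutral).  β-BOARD v1 row R5 «G₃ ε-BOUNDARY», half R5b (α): THE LABEL-FREE G₃ ORBIT LAYER BY TRANSPORT ((β) = the head, LH7-p06 (g0)).  2026-09-04.
-/
import Summits.HodgeConjecture.HodgeConjecture.Theorems.F0P3cDyRamLabelledOddSwapEngine            -- ★ p861439 (this seat): `finsum_stratum_shell_labelledOdd_div_relIndex_perm`, `labelledOddCount_div_relIndex_mapGL_perm`; brings ★ §P∕§P₂ kits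
import Summits.HodgeConjecture.HodgeConjecture.Theorems.F0P3cDyRamLabelledOddGluedDecomposition    -- ★ (LH7-p05 (g0)): `finsum_labelledOdd_div_relIndex_glued_sep_eq`; brings ★ κG-C1 (`orbit_mass_eq_pow`, `mapGL_latt_glued_rep_of_depths`), ★ κG-A1, ★ (iv-a)∕(iv-b-idx), ★ B5 (iii)
import Summits.HodgeConjecture.HodgeConjecture.Theorems.F0P3cDyRamDiagonalGluedStratum             -- ★ (LH4-p08): `stratum_G1_eq`
import Summits.HodgeConjecture.HodgeConjecture.Theorems.F0P3cDyRamLabelledOddPureStrataG3Shell     -- ★ p861341∕p861424 (LH7-p06 (g0)): `shell_of_mem_stratum_G3_of_guard`; brings ★ DEFS №5 `mcOfRecord`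
import Literature.NumberTheory.LocalFields.WildQuadraticDatumTraceBound                             -- ★ `trace_bound_of_isRamifiedQuadraticDatum`
import HarnessLib

/-!
# Crux `H413`, line LH4 «(D-RAM) FOUR-FRAME» — (β-BAL) Stage B, β-BOARD R5b (α): THE G₃ ORBIT LAYER BY TRANSPORT — the stratum `(2ρ+2t, 2ρ+2t, 2ρ)` is the union of
# the unit-torus orbits of the normal forms `M(g) = latt (1 0 0; (1+g)⁻¹ ϖ^{ρ+2t} 0; (1+g)⁻¹ −ϖ^{ρ+2t}g⁻¹ ϖ^{2ρ})`, `g ∈ F`, `|g| = |ϖ|^{2t}` mod `𝔭^{ρ+2t}`, and the labelled-odd table of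
# the stratum (any torus-equivariant label, any diagonal shell cut) is `|orbit| · Σ_g (table at M(g))`

Cell `hodgecm-mathlib` (D-0151), FLOOR 0, crux item H413 = `stmt-HodgeConjecture-24833`, route `HCCMUnconditional`; squad F0∕P3c∕LH4.  THEOREMS ONLY (no `def`, no instance, no
notation, no `sorry`, default heartbeats); ★-only imports; lane `--supports stmt-HodgeConjecture-24833 --as helper` (count-neutral); pays NO row, states NO law.
THE MATHEMATICS.  `P = (0 2)` carries the glued G₁ family of `(ρ, 2t)` for `P⁻¹TP` onto the G₃ stratum of `T` (★ §P `image_mapGL_stratum`, ★ `stratum_G1_eq`); the image of the class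
representative `latt V(1,1,g)` is, after unimodular column reduction, the G₃ NORMAL FORM `M(g)` (§2) with explicit polarisation `D(g) ∘ (0 2) = π₀^{−(ρ+t)}·(−(1+g)⁻¹, 1, g)` (★ κG-A1);
the labelled count and `[𝒰 : N(S̃)]` move with `P` (★ engine p861439), the transported label `Λ ∘ P` is torus-equivariant (§1), so ★ LH7-p05's orbit decomposition of the glued family
(`…LabelledOddGluedDecomposition`) applies on the G₁ side and comes back summand by summand.  §1 `mapGL_perm_mapGL_diagGLUnits`, `isTorusEquivariantLabel_comp_mapGL_perm`; §2
`mapGL_swap02_latt_glued_rep_eq`, `isVertexLattice_zero_latt_G3_rep`, `mapGL_latt_G3_rep_of_depths`, `latt_G3_rep_mem_stratum_of_depths`, `stabiliserWeight_latt_G3_rep_eq`; §3 HEADS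
`finsum_stratum_G3_shell_labelledOdd_div_relIndex_eq_card_mul_sum` (any diagonal `T`, general filter) and `…_of_read` (element datum on the read + tube guard: the filter is all of `R`).
CONSUMER: LH7-p06 (g0)'s R5b head (per-representative value on `M(g)` with `D(g)`, then the `g`-sums).  HONEST LABEL: count-neutral bookkeeping, sums nothing to a number;
R5b∕table∕(β-BAL)∕(β)∕T₊ OPEN; `HC_CM` is proved only modulo the 7 printed citations (2 remaining named inputs: hLiu418 = `stmt-HodgeConjecture-24832`, h413 = `stmt-HodgeConjecture-24833`)
until rung 0 closes.
References: [Kottwitz1986BaseChangeUnits] §1 pp. 240–241 · [Rogawski1990] §4.9 Prop. 4.9.1 (a)(b) p. 55 · [LanglandsShelstad1987] §3 · [Jacobowitz1962] §4, §7 · [Serre1980Trees] II §1.1.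
-/

set_option autoImplicit false

noncomputable section

namespace Summit.HodgeConjecture.HodgeConjecture.Cruxes.H413.F0P3cDyRamLabelledOddG3OrbitDecomposition

open Matrix WithZero
open Literature.NumberTheory.Automorphic Literature.NumberTheory.Automorphic.HermitianLattice
open Literature.NumberTheory.Automorphic.UnitaryLatticeTree Literature.NumberTheory.Automorphic.UnitaryThreeFourFrame
open Literature.NumberTheory.LocalFields Literature.NumberTheory.LocalFields.WildQuadraticDatum
open Summit.HodgeConjecture.HodgeConjecture.Cruxes.H413.F0P3cDyRamFourFrameCensusDefs
open Summit.HodgeConjecture.HodgeConjecture.Cruxes.H413.F0P3cDyRamStageOneBDefs (mcOfRecord)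
open Summit.HodgeConjecture.HodgeConjecture.Cruxes.H413.F0P3cDyRamLabelledOddPureStrataG3Shell (shell_of_mem_stratum_G3_of_guard)
open Summit.HodgeConjecture.HodgeConjecture.Cruxes.H413.F0P3cDyRamDiagonalTorusDefs
open Summit.HodgeConjecture.HodgeConjecture.Cruxes.H413.F0P3cDyRamDiagonalStrataDefs
open Summit.HodgeConjecture.HodgeConjecture.Cruxes.H413.F0P3cDyRamDiagonalPermutation
open Summit.HodgeConjecture.HodgeConjecture.Cruxes.H413.F0P3cDyRamDiagonalPermutationTwo
open Summit.HodgeConjecture.HodgeConjecture.Cruxes.H413.F0P3cDyRamDiagonalKappaPermutation (exists_gl_rescale_swap02)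
open Summit.HodgeConjecture.HodgeConjecture.Cruxes.H413.F0P3cDyRamLabelledOddCountDefs
open Summit.HodgeConjecture.HodgeConjecture.Cruxes.H413.F0P3cDyRamLabelledStrataPermutation (latticeInLevel_diagonal_mapGL_perm_iff)
open Summit.HodgeConjecture.HodgeConjecture.Cruxes.H413.F0P3cDyRamLevelCountDiagonalModel (latticeInLevel_diagonal_mapGL_iff)
open Summit.HodgeConjecture.HodgeConjecture.Cruxes.H413.F0P3cDyRamLabelledOddSwapEngine
open Summit.HodgeConjecture.HodgeConjecture.Cruxes.H413.F0P3cDyRamLabelledOddGluedDecomposition (finsum_labelledOdd_div_relIndex_glued_sep_eq)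
open Summit.HodgeConjecture.HodgeConjecture.Cruxes.H413.F0P3cDyRamDiagonalGluedStratum (stratum_G1_eq)
open Summit.HodgeConjecture.HodgeConjecture.Cruxes.H413.F0P3cDyRamDiagonalGluedTorusOrbits (exists_gl_coe_eq_glued)
open Summit.HodgeConjecture.HodgeConjecture.Cruxes.H413.F0P3cDyRamDiagonalKappaGluedClassForm (isVertexLattice_zero_latt_glued_rep)
open Summit.HodgeConjecture.HodgeConjecture.Cruxes.H413.F0P3cDyRamDiagonalKappaGluedDecomposition (orbit_mass_eq_pow mapGL_latt_glued_rep_of_depths)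
open Summit.HodgeConjecture.HodgeConjecture.Cruxes.H413.F0P3cDyRamDiagonalGluedStabiliserIndex (stabiliserWeight_latt_glued_tube_eq ne_zero_and_v_lt_one_of_v_eq_exp)
open Summit.HodgeConjecture.HodgeConjecture.Cruxes.H413.F0P3cDyRamDiagonalStratumTools (latt_mul_eq_latt_of_isIntMatrix)
open Summit.HodgeConjecture.HodgeConjecture.Cruxes.H413.F0P3cDyRamDiagonalGluedTubeCriterion (isIntMatrix_of_fin_three)
open scoped Valued WithZero Matrix MatrixGroups

/-! ## §1  A coordinate permutation past a diagonal; the transported label is torus-equivariant -/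

section Perm

variable {K : Type*} [Field K] [Valued K ℤᵐ⁰] {N : ℕ}

/-- **`P·(diag(z)·M) = diag(z ∘ π)·(P·M)`** for `P` the matrix of `π` (`P·diag(z)·P⁻¹ = diag(z ∘ π)`, ★ `coe_conj_eq_diagonal`). [cite: Serre1980Trees, II §1.1] -/
theorem mapGL_perm_mapGL_diagGLUnits {π : Equiv.Perm (Fin N)} (P : GL (Fin N) K) (hP : (P : Matrix (Fin N) (Fin N) K) = π.permMatrix K)
    (z : Fin N → Kˣ) (M : Submodule 𝒪[K] (Fin N → K)) :
    mapGL P (mapGL (diagGLUnits z) M) = mapGL (diagGLUnits (fun i => z (π i))) (mapGL P M) := by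
  have e : P⁻¹ * diagGLUnits (fun i => z (π i)) * P = diagGLUnits z := by
    refine Units.ext ?_
    rw [coe_conj_eq_diagonal P hP (diagGLUnits _) (coe_diagGLUnits _), coe_diagGLUnits]
    congr 1
    funext j
    simp only [Function.comp_apply, Equiv.apply_symm_apply]
  rw [← mapGL_mul, ← mapGL_mul, ← e]
  congr 1
  group

end Perm

section Label

variable {K : Type} [Field K] [Valued K ℤᵐ⁰]

/-- **THE TRANSPORTED LABEL IS TORUS-EQUIVARIANT**: `Λ` torus-equivariant ⟹ so is `(Λ ∘ P) M D := Λ (P·M) (D ∘ π)` (§1: `P·diag(z) = diag(z∘π)·P`). [cite: Kottwitz1986BaseChangeUnits, §1 pp. 240–241] -/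
theorem isTorusEquivariantLabel_comp_mapGL_perm (σ : K →+* K) {π : Equiv.Perm (Fin 3)} (P : GL (Fin 3) K)
    (hP : (P : Matrix (Fin 3) (Fin 3) K) = π.permMatrix K) {Λ : Submodule 𝒪[K] (Fin 3 → K) → (Fin 3 → K) → Prop} (hΛ : IsTorusEquivariantLabel σ Λ) :
    IsTorusEquivariantLabel σ (fun (M : Submodule 𝒪[K] (Fin 3 → K)) (D : Fin 3 → K) => Λ (mapGL P M) (D ∘ ⇑π)) := by
  intro z M D
  show Λ (mapGL P (mapGL (diagGLUnits z) M)) (D ∘ ⇑π) ↔ Λ (mapGL P M) ((fun j => D j * (((z j : Kˣ) : K) * σ ((z j : Kˣ) : K))) ∘ ⇑π)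
  rw [mapGL_perm_mapGL_diagGLUnits P hP z M, hΛ (fun i => z (π i)) (mapGL P M) (D ∘ ⇑π)]
  exact Iff.rfl

end Label

/-! ## §2  The (0 2)-image of the glued representative `latt V(1,1,g)` is the G₃ normal form `M(g)`; its polarisation, stability and weight -/

section Rep

variable {K : Type} [Field K] [Valued K ℤᵐ⁰]

omit [Valued K ℤᵐ⁰] in
/-- `P·V(1,1,g)` has the ROWS of `V(1,1,g)` reversed: `(1+g, ϖ^ρ, ϖ^{2ρ+2t}; 1, ϖ^ρ, 0; 1, 0, 0)` (Mathlib `PEquiv.toMatrix_toPEquiv_mul`). [cite: Serre1980Trees, II §1.1] -/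
theorem permMatrix_swap02_mul_glued_rep (P : GL (Fin 3) K) (hP : (P : Matrix (Fin 3) (Fin 3) K) = (Equiv.swap (0 : Fin 3) 2).permMatrix K)
    (ϖ g : K) (ρ t : ℕ) (V : GL (Fin 3) K) (hV : (V : Matrix (Fin 3) (Fin 3) K) = !![1, 0, 0; 1, ϖ ^ ρ, 0; 1 * 1 + g, ϖ ^ ρ * 1, ϖ ^ (2 * ρ + 2 * t)]) :
    ((P * V : GL (Fin 3) K) : Matrix (Fin 3) (Fin 3) K) = !![1 + g, ϖ ^ ρ, ϖ ^ (2 * ρ + 2 * t); 1, ϖ ^ ρ, 0; 1, 0, 0] := by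
  rw [Units.val_mul, hP, hV]
  unfold Equiv.Perm.permMatrix
  rw [PEquiv.toMatrix_toPEquiv_mul]
  ext i j
  fin_cases i <;> fin_cases j <;> simp [Matrix.submatrix_apply, Equiv.swap_apply_def]

/-- **THE (0 2)-IMAGE OF `latt V(1,1,g)` IS THE G₃ NORMAL FORM** `M(g) = latt (1 0 0; u ϖ^{ρ+2t} 0; u −ϖ^{ρ+2t}g⁻¹ ϖ^{2ρ})`, `u = (1+g)⁻¹` (`|g| = |ϖ|^{2t}`, `t ≥ 1`): the column operations
`Q = (u, −ϖ^{ρ+2t}∕g, ϖ^{2ρ}; 0, ϖ^{2t}∕(gu), −ϖ^ρ; 0, 0, −g∕ϖ^{2t})` and `Q⁻¹` are integral and `(P·V)·Q` is the normal form (★ `latt_mul_eq_latt_of_isIntMatrix`). [cite: Serre1980Trees, II §1.1] -/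
theorem mapGL_swap02_latt_glued_rep_eq (P : GL (Fin 3) K) (hP : (P : Matrix (Fin 3) (Fin 3) K) = (Equiv.swap (0 : Fin 3) 2).permMatrix K)
    {ϖ : K} (hϖ : Valued.v ϖ = exp (-1 : ℤ)) (ρ t : ℕ) (ht : 1 ≤ t) {g : K} (hg : Valued.v g = Valued.v ϖ ^ (2 * t))
    (V : GL (Fin 3) K) (hV : (V : Matrix (Fin 3) (Fin 3) K) = !![1, 0, 0; 1, ϖ ^ ρ, 0; 1 * 1 + g, ϖ ^ ρ * 1, ϖ ^ (2 * ρ + 2 * t)]) :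
    mapGL P (latt (V : Matrix (Fin 3) (Fin 3) K)) =
      latt (!![1, 0, 0; (1 + g)⁻¹, ϖ ^ (ρ + 2 * t), 0; (1 + g)⁻¹, -(ϖ ^ (ρ + 2 * t) * g⁻¹), ϖ ^ (2 * ρ)] : Matrix (Fin 3) (Fin 3) K) := by
  obtain ⟨hϖ0, hϖ1⟩ := ne_zero_and_v_lt_one_of_v_eq_exp hϖ
  have hvϖ : 0 < Valued.v ϖ := (Valuation.pos_iff _).2 hϖ0
  have hϖ1' : Valued.v ϖ ≤ 1 := hϖ1.le
  have hpow : ∀ n : ℕ, Valued.v (ϖ ^ n) ≤ 1 := fun n => by rw [map_pow]; exact pow_le_one₀ zero_le hϖ1'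
  have hgv : Valued.v g < 1 := by rw [hg]; exact pow_lt_one₀ zero_le hϖ1 (by omega)
  have hg0 : g ≠ 0 := fun h => by rw [h, map_zero] at hg; exact (pow_ne_zero _ hvϖ.ne') hg.symm
  have h1g : Valued.v (1 + g) = 1 := Valued.v.map_one_add_of_lt hgv
  have h1g0 : (1 : K) + g ≠ 0 := fun h => by rw [h, map_zero] at h1g; exact zero_ne_one h1g
  -- the column operations and their inverse
  set Q : Matrix (Fin 3) (Fin 3) K := !![(1 + g)⁻¹, -(ϖ ^ (ρ + 2 * t) * g⁻¹), ϖ ^ (2 * ρ); 0, ϖ ^ (2 * t) * (g * (1 + g)⁻¹)⁻¹, -(ϖ ^ ρ); 0, 0, -(g * (ϖ ^ (2 * t))⁻¹)] with hQ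
  set Q' : Matrix (Fin 3) (Fin 3) K := !![1 + g, ϖ ^ ρ, ϖ ^ (2 * ρ + 2 * t); 0, g * (1 + g)⁻¹ * (ϖ ^ (2 * t))⁻¹, -((1 + g)⁻¹ * ϖ ^ ρ); 0, 0, -(ϖ ^ (2 * t) * g⁻¹)] with hQ'
  have hQQ' : Q * Q' = 1 := by
    rw [hQ, hQ', Matrix.mul_fin_three, Matrix.one_fin_three]
    ext i j
    fin_cases i <;> fin_cases j <;> simp <;> field_simp <;> ring
  have hQ'Q : Q' * Q = 1 := mul_eq_one_comm.1 hQQ'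
  -- integrality
  have hv1g : Valued.v (1 + g)⁻¹ = 1 := by rw [map_inv₀, h1g, inv_one]
  have hvq : Valued.v (ϖ ^ (ρ + 2 * t) * g⁻¹) = Valued.v (ϖ ^ ρ) := by
    rw [map_mul, map_inv₀, hg, map_pow, map_pow, pow_add, mul_assoc, mul_inv_cancel₀ (pow_ne_zero _ hvϖ.ne'), mul_one]
  have hve : Valued.v (ϖ ^ (2 * t) * (g * (1 + g)⁻¹)⁻¹) = 1 := by
    rw [map_mul, map_inv₀, map_mul, hv1g, mul_one, hg, map_pow, mul_inv_cancel₀ (pow_ne_zero _ hvϖ.ne')]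
  have hvi : Valued.v (g * (ϖ ^ (2 * t))⁻¹) = 1 := by
    rw [map_mul, map_inv₀, hg, map_pow, mul_inv_cancel₀ (pow_ne_zero _ hvϖ.ne')]
  have hve' : Valued.v (g * (1 + g)⁻¹ * (ϖ ^ (2 * t))⁻¹) = 1 := by
    rw [map_mul, map_mul, hv1g, mul_one, map_inv₀, hg, map_pow, mul_inv_cancel₀ (pow_ne_zero _ hvϖ.ne')]
  have hvi' : Valued.v (ϖ ^ (2 * t) * g⁻¹) = 1 := by
    rw [map_mul, map_inv₀, hg, map_pow, mul_inv_cancel₀ (pow_ne_zero _ hvϖ.ne')]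
  have hQi : IsIntMatrix Q := by
    rw [hQ]
    refine isIntMatrix_of_fin_three ?_ ?_ ?_ ?_ ?_ ?_ ?_ ?_ ?_
    · rw [hv1g]
    · rw [Valuation.map_neg, hvq]; exact hpow ρ
    · exact hpow _
    · rw [map_zero]; exact zero_le
    · rw [hve]
    · rw [Valuation.map_neg]; exact hpow ρ
    · rw [map_zero]; exact zero_le
    · rw [map_zero]; exact zero_le
    · rw [Valuation.map_neg, hvi]
  have hQ'i : IsIntMatrix Q' := by
    rw [hQ']
    refine isIntMatrix_of_fin_three ?_ ?_ ?_ ?_ ?_ ?_ ?_ ?_ ?_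
    · rw [h1g]
    · exact hpow ρ
    · exact hpow _
    · rw [map_zero]; exact zero_le
    · rw [hve']
    · rw [Valuation.map_neg, map_mul, hv1g, one_mul]; exact hpow ρ
    · rw [map_zero]; exact zero_le
    · rw [map_zero]; exact zero_le
    · rw [Valuation.map_neg, hvi']
  -- the product `(P·V)·Q` is the normal form
  have hPV := permMatrix_swap02_mul_glued_rep P hP ϖ g ρ t V hV
  have hprod : ((P * V : GL (Fin 3) K) : Matrix (Fin 3) (Fin 3) K) * Q =
      !![1, 0, 0; (1 + g)⁻¹, ϖ ^ (ρ + 2 * t), 0; (1 + g)⁻¹, -(ϖ ^ (ρ + 2 * t) * g⁻¹), ϖ ^ (2 * ρ)] := by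
    rw [hPV, hQ, Matrix.mul_fin_three]
    ext i j
    fin_cases i <;> fin_cases j <;> simp <;> field_simp <;> ring
  have hdet : IsUnit ((P * V : GL (Fin 3) K) : Matrix (Fin 3) (Fin 3) K).det := Matrix.isUnits_det_units _
  have hdetQ : IsUnit Q.det := by
    have h := congrArg Matrix.det hQQ'
    rw [Matrix.det_mul, Matrix.det_one] at h
    exact IsUnit.of_mul_eq_one _ h
  have hQinv : Q⁻¹ = Q' := Matrix.inv_eq_right_inv hQQ'
  rw [mapGL_latt, ← hprod]
  exact (latt_mul_eq_latt_of_isIntMatrix hdet hdetQ hQi (by rw [hQinv]; exact hQ'i)).symm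

/-- **THE EXPLICIT POLARISATION OF `M(g)`**: a type-`0` vertex lattice of `diag(D(g) ∘ (0 2))`, `D(g) ∘ (0 2) = π₀^{−(ρ+t)}·(−(1+g)⁻¹, 1, g)` (★ κG-A1 transported by ★ §P₂ and §2);
so `ω(D₀) = ω(−(1+g)⁻¹)`, `ω(D₁) = 1`, `ω(D₂) = ω(g)`, `D₁N(u)∕D₀ = −(1+g)⁻¹`, `D₂∕D₁ = g`. [cite: Jacobowitz1962, §4, §7] [cite: Kottwitz1986BaseChangeUnits, §1 pp. 240–241] -/
theorem isVertexLattice_zero_latt_G3_rep {σ : K →+* K} (hσ : ∀ a, σ (σ a) = a) (hvσ : ∀ a, Valued.v (σ a) = Valued.v a)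
    {ϖ : K} (hϖ : Valued.v ϖ = exp (-1 : ℤ)) (ρ t : ℕ) (ht : 1 ≤ t) {g : K} (hσg : σ g = g) (hg : Valued.v g = Valued.v ϖ ^ (2 * t)) :
    IsVertexLattice σ ϖ (Matrix.diagonal ![-(((ϖ * σ ϖ) ^ (ρ + t))⁻¹ * (1 + g)⁻¹), ((ϖ * σ ϖ) ^ (ρ + t))⁻¹, ((ϖ * σ ϖ) ^ (ρ + t))⁻¹ * g]) 0
      (latt (!![1, 0, 0; (1 + g)⁻¹, ϖ ^ (ρ + 2 * t), 0; (1 + g)⁻¹, -(ϖ ^ (ρ + 2 * t) * g⁻¹), ϖ ^ (2 * ρ)] : Matrix (Fin 3) (Fin 3) K)) := by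
  obtain ⟨hϖ0, hϖ1⟩ := ne_zero_and_v_lt_one_of_v_eq_exp hϖ
  obtain ⟨P, hP⟩ := exists_gl_coe_eq_permMatrix (K := K) (Equiv.swap (0 : Fin 3) 2)
  obtain ⟨V, hV⟩ := exists_gl_coe_eq_glued (1 : K) 1 g (pow_ne_zero ρ hϖ0) (pow_ne_zero (2 * ρ + 2 * t) hϖ0)
  have h := isVertexLattice_zero_latt_glued_rep hσ hvσ hϖ0 hϖ1 ρ t hσg hg ht V hV
  rw [← mapGL_swap02_latt_glued_rep_eq P hP hϖ ρ t ht hg V hV, isVertexLattice_diagonal_mapGL_perm_iff σ ϖ P hP]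
  have e : (![-(((ϖ * σ ϖ) ^ (ρ + t))⁻¹ * (1 + g)⁻¹), ((ϖ * σ ϖ) ^ (ρ + t))⁻¹, ((ϖ * σ ϖ) ^ (ρ + t))⁻¹ * g] : Fin 3 → K) ∘
      ⇑(Equiv.swap (0 : Fin 3) 2).symm = ![((ϖ * σ ϖ) ^ (ρ + t))⁻¹ * g, ((ϖ * σ ϖ) ^ (ρ + t))⁻¹, -(((ϖ * σ ϖ) ^ (ρ + t))⁻¹ * (1 + g)⁻¹)] := by
    ext j; fin_cases j <;> rfl
  rw [e]
  exact h

/-- **ON THE TUBE `M(g)` IS `T`-STABLE** (`T = diag(α, β, 1)`; `2ρ + 2t ≤ n₃`, `2ρ ≤ n₂`, `ρ ≤ n₁`): ★ `mapGL_latt_glued_rep_of_depths` at the rescaled datum `(α⁻¹, βα⁻¹; n₃, n₂, n₁)`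
carried through `P = (0 2)` (★ `exists_gl_rescale_swap02`, ★ `mapGL_eq_of_coe_eq_smul`, ★ `mapGL_conj_mapGL_eq_iff`, §2). [cite: Kottwitz1986BaseChangeUnits, §1 pp. 240–241] -/
theorem mapGL_latt_G3_rep_of_depths {σ : K →+* K} (hvσ : ∀ a, Valued.v (σ a) = Valued.v a) {ϖ : K} (hϖ : Valued.v ϖ = exp (-1 : ℤ))
    {α β : K} {N₀ n₁ n₂ n₃ : ℕ} (hE : IsElementDatum σ ϖ N₀ α β n₁ n₂ n₃) (T : GL (Fin 3) K) (hT : (T : Matrix (Fin 3) (Fin 3) K) = Matrix.diagonal ![α, β, 1])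
    {ρ t : ℕ} (ht : 1 ≤ t) (hρ₁ : 2 * ρ + 2 * t ≤ n₃) (hρ₂ : 2 * ρ ≤ n₂) (hρ₃ : ρ ≤ n₁) {g : K} (hg : Valued.v g = Valued.v ϖ ^ (2 * t)) :
    mapGL T (latt (!![1, 0, 0; (1 + g)⁻¹, ϖ ^ (ρ + 2 * t), 0; (1 + g)⁻¹, -(ϖ ^ (ρ + 2 * t) * g⁻¹), ϖ ^ (2 * ρ)] : Matrix (Fin 3) (Fin 3) K)) =
      latt (!![1, 0, 0; (1 + g)⁻¹, ϖ ^ (ρ + 2 * t), 0; (1 + g)⁻¹, -(ϖ ^ (ρ + 2 * t) * g⁻¹), ϖ ^ (2 * ρ)] : Matrix (Fin 3) (Fin 3) K) := by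
  obtain ⟨hϖ0, hϖ1⟩ := ne_zero_and_v_lt_one_of_v_eq_exp hϖ
  obtain ⟨P, hP⟩ := exists_gl_coe_eq_permMatrix (K := K) (Equiv.swap (0 : Fin 3) 2)
  obtain ⟨V, hV⟩ := exists_gl_coe_eq_glued (1 : K) 1 g (pow_ne_zero ρ hϖ0) (pow_ne_zero (2 * ρ + 2 * t) hϖ0)
  obtain ⟨T'', hT'', hTT⟩ := exists_gl_rescale_swap02 hE hT P hP
  have hE' := isElementDatum_rescale hvσ hE
  obtain ⟨hαn, hβn, -, -, -, h₁, h₂, h₃, -, -, -⟩ := hE'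
  have hvunit : ∀ {x : K}, x * σ x = 1 → Valued.v x = 1 := fun {x} hx => by
    have h : Valued.v x * Valued.v x = 1 := by nth_rw 2 [← hvσ x]; rw [← map_mul, hx, map_one]
    rw [← pow_two] at h
    exact ((pow_eq_one_iff).1 h).resolve_right two_ne_zero
  have hα := hvunit hαn
  have hβ := hvunit hβn
  have hα0 : Valued.v α⁻¹ = 1 := hα
  have h₃' : Valued.v (β * α⁻¹ - α⁻¹) = Valued.v ϖ ^ n₁ := by rw [Valuation.map_sub_swap, h₃]
  have hst := mapGL_latt_glued_rep_of_depths hϖ0 hϖ1.le hα hβ T'' hT'' h₁ h₂ h₃' hρ₁ hρ₂ hρ₃ hg V hV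
  rw [mapGL_eq_of_coe_eq_smul hα0 hTT, ← mapGL_conj_mapGL_eq_iff P (P⁻¹ * T * P), show P * (P⁻¹ * T * P) * P⁻¹ = T by group,
    mapGL_swap02_latt_glued_rep_eq P hP hϖ ρ t ht hg V hV] at hst
  exact hst

/-- **`M(g)` IS A MEMBER OF THE STRATUM `(2ρ+2t, 2ρ+2t, 2ρ)` ON THE TUBE** (`σ g = g`, `|g| = |ϖ|^{2t}`, `ρ, t ≥ 1`): `latt V(1,1,g)` is a `P⁻¹TP`-stable dualisable member of the glued family
(★ κG-A1, ★ `stratum_G1_eq`) and `P` carries that stratum onto the G₃ stratum (★ `image_mapGL_stratum`). [cite: Kottwitz1986BaseChangeUnits, §1 pp. 240–241] -/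
theorem latt_G3_rep_mem_stratum_of_depths {σ : K →+* K} {ϖ : K} {d t₂ : ℕ} (hD : IsRamifiedQuadraticDatum σ ϖ d t₂)
    {α β : K} {N₀ n₁ n₂ n₃ : ℕ} (hE : IsElementDatum σ ϖ N₀ α β n₁ n₂ n₃) (T : GL (Fin 3) K) (hT : (T : Matrix (Fin 3) (Fin 3) K) = Matrix.diagonal ![α, β, 1])
    {ρ t : ℕ} (hρ : 1 ≤ ρ) (ht : 1 ≤ t) (hρ₁ : 2 * ρ + 2 * t ≤ n₃) (hρ₂ : 2 * ρ ≤ n₂) (hρ₃ : ρ ≤ n₁)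
    {g : K} (hσg : σ g = g) (hg : Valued.v g = Valued.v ϖ ^ (2 * t)) :
    latt (!![1, 0, 0; (1 + g)⁻¹, ϖ ^ (ρ + 2 * t), 0; (1 + g)⁻¹, -(ϖ ^ (ρ + 2 * t) * g⁻¹), ϖ ^ (2 * ρ)] : Matrix (Fin 3) (Fin 3) K) ∈
      stratum σ ϖ T ![2 * ρ + 2 * t, 2 * ρ + 2 * t, 2 * ρ] := by
  obtain ⟨hσ, hvσ, hϖ, hfix, -, -, -⟩ := id hD
  obtain ⟨hϖ0, hϖ1⟩ := ne_zero_and_v_lt_one_of_v_eq_exp hϖ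
  obtain ⟨P, hP⟩ := exists_gl_coe_eq_permMatrix (K := K) (Equiv.swap (0 : Fin 3) 2)
  obtain ⟨V, hV⟩ := exists_gl_coe_eq_glued (1 : K) 1 g (pow_ne_zero ρ hϖ0) (pow_ne_zero (2 * ρ + 2 * t) hϖ0)
  have hrep := mapGL_swap02_latt_glued_rep_eq P hP hϖ ρ t ht hg V hV
  -- `latt V(1,1,g)` is in the G₁ stratum of `P⁻¹TP`
  have hstab : mapGL (P⁻¹ * T * P) (latt (V : Matrix (Fin 3) (Fin 3) K)) = latt (V : Matrix (Fin 3) (Fin 3) K) := by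
    rw [← mapGL_conj_mapGL_eq_iff P (P⁻¹ * T * P), show P * (P⁻¹ * T * P) * P⁻¹ = T by group, hrep]
    exact mapGL_latt_G3_rep_of_depths hvσ hϖ hE T hT ht hρ₁ hρ₂ hρ₃ hg
  have hpol := isVertexLattice_zero_latt_glued_rep hσ hvσ hϖ0 hϖ1 ρ t hσg hg ht V hV
  have hπ₀ : σ (((ϖ * σ ϖ) ^ (ρ + t))⁻¹) = ((ϖ * σ ϖ) ^ (ρ + t))⁻¹ := by rw [map_inv₀, map_pow, map_mul, hσ, mul_comm]
  have hπ₀0 : ((ϖ * σ ϖ) ^ (ρ + t))⁻¹ ≠ (0 : K) := by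
    refine inv_ne_zero (pow_ne_zero _ (mul_ne_zero hϖ0 ?_))
    intro h; apply hϖ0; simpa [hσ] using congrArg σ h
  have hgv : Valued.v g < 1 := by rw [hg]; exact pow_lt_one₀ zero_le hϖ1 (by omega)
  have hg0 : g ≠ 0 := fun h => by rw [h, map_zero] at hg; exact (pow_ne_zero _ ((Valuation.pos_iff _).2 hϖ0).ne') hg.symm
  have h1g : Valued.v (1 + g) = 1 := Valued.v.map_one_add_of_lt hgv
  have h1g0 : (1 : K) + g ≠ 0 := fun h => by rw [h, map_zero] at h1g; exact zero_ne_one h1g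
  have hdual : IsDualisableLattice σ ϖ (latt (V : Matrix (Fin 3) (Fin 3) K)) := by
    refine ⟨_, fun i => ?_, hpol⟩
    fin_cases i
    · exact ⟨by simp [map_mul, hπ₀, hσg], mul_ne_zero hπ₀0 hg0⟩
    · exact ⟨by simpa using hπ₀, by simpa using hπ₀0⟩
    · refine ⟨?_, ?_⟩
      · simp [map_neg, map_mul, map_inv₀, map_add, hπ₀, hσg]
      · simpa using mul_ne_zero hπ₀0 (inv_ne_zero h1g0)
  have hmem : latt (V : Matrix (Fin 3) (Fin 3) K) ∈ stratum σ ϖ (P⁻¹ * T * P) ![2 * ρ, 2 * ρ + 2 * t, 2 * ρ + 2 * t] := by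
    rw [stratum_G1_eq hvσ hfix hϖ (P⁻¹ * T * P) hρ (by omega : 1 ≤ 2 * t)]
    exact ⟨1, 1, g, by simp, by simp, hg, by rw [hV], hstab, hdual⟩
  have ha : (![2 * ρ + 2 * t, 2 * ρ + 2 * t, 2 * ρ] : Fin 3 → ℕ) ∘ ⇑(Equiv.swap (0 : Fin 3) 2).symm = ![2 * ρ, 2 * ρ + 2 * t, 2 * ρ + 2 * t] := by
    ext j; fin_cases j <;> rfl
  rw [← hrep, ← image_mapGL_stratum σ ϖ P hP T ![2 * ρ + 2 * t, 2 * ρ + 2 * t, 2 * ρ], ha]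
  exact ⟨_, hmem, rfl⟩

/-- **THE WEIGHT OF `M(g)`**: `w(M(g)) = 1 ∕ ((q−1)q^{⌈(ρ+2t)∕2⌉−1} · (q−1)q^{ρ−1})` (★ B5 (iii) on `latt V(1,1,g)`, ★ `stabiliserWeight_mapGL_perm`); so `|orbit| · w(M(g)) = q^{2ρ+2t−⌈(ρ+2t)∕2⌉}`
(★ `orbit_mass_eq_pow`). [cite: Kottwitz1986BaseChangeUnits, §1 pp. 240–241] [cite: Rogawski1990, §4.9 Prop. 4.9.1 (a) p. 55] -/
theorem stabiliserWeight_latt_G3_rep_eq {σ : K →+* K} {ϖ : K} {d t₂ : ℕ} (hD : IsRamifiedQuadraticDatum σ ϖ d t₂) [Finite 𝓀[K]]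
    {ρ t : ℕ} (hρ : 1 ≤ ρ) (ht : 1 ≤ t) {g : K} (hσg : σ g = g) (hg : Valued.v g = Valued.v ϖ ^ (2 * t)) :
    stabiliserWeight σ (latt (!![1, 0, 0; (1 + g)⁻¹, ϖ ^ (ρ + 2 * t), 0; (1 + g)⁻¹, -(ϖ ^ (ρ + 2 * t) * g⁻¹), ϖ ^ (2 * ρ)] : Matrix (Fin 3) (Fin 3) K)) =
      ((((Nat.card 𝓀[K] - 1) * Nat.card 𝓀[K] ^ ((ρ + 2 * t + 1) / 2 - 1)) * ((Nat.card 𝓀[K] - 1) * Nat.card 𝓀[K] ^ (ρ - 1)) : ℕ) : ℚ)⁻¹ := by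
  obtain ⟨hσ, hvσ, hϖ, hfix, hdd, -, -⟩ := id hD
  obtain ⟨hϖ0, -⟩ := ne_zero_and_v_lt_one_of_v_eq_exp hϖ
  obtain ⟨P, hP⟩ := exists_gl_coe_eq_permMatrix (K := K) (Equiv.swap (0 : Fin 3) 2)
  obtain ⟨V, hV⟩ := exists_gl_coe_eq_glued (1 : K) 1 g (pow_ne_zero ρ hϖ0) (pow_ne_zero (2 * ρ + 2 * t) hϖ0)
  rw [← mapGL_swap02_latt_glued_rep_eq P hP hϖ ρ t ht hg V hV, stabiliserWeight_mapGL_perm σ P hP]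
  exact stabiliserWeight_latt_glued_tube_eq hσ hvσ hfix hϖ hdd hρ t (by simp) (by simp) hg V hV hσg
    (by rw [one_mul, map_one, one_mul, hσg, sub_self, map_zero]; exact zero_le)

end Rep

/-! ## §3  HEAD — the labelled-odd table of the G₃ stratum decomposes over the normal forms `M(g)` -/

section Head

variable {K : Type} [Field K] [Valued K ℤᵐ⁰] [Fintype 𝓀[K]]

open Classical in
/-- **HEAD — THE G₃ ORBIT DECOMPOSITION OF THE LABELLED-ODD TABLE.**  `T = diag(s₃)` ANY diagonal, `|2| < 1`, `ρ, t ≥ 1`, `R` a complete irredundant system of the fixed `g`,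
`|g| = |ϖ|^{2t}`, modulo `𝔭^{ρ+2t}` (★ (iv-c) letters), `Λ` ANY torus-equivariant label, ANY three-token diagonal shell cut, any `tv`, slot `i`:
`Σᶠ_{M ∈ stratum (2ρ+2t,2ρ+2t,2ρ), shell M} m^Λ_i(M)∕[𝒰 : N(S̃(M))] = ((q−1)q^{ρ+2t−1})((q−1)q^{2ρ−1}) · Σ_{g ∈ R, T·M(g) = M(g), shell M(g)} m^Λ_i(M(g))∕[𝒰 : N(S̃(M(g)))]` — ★ engine §4 at `(0 2)` ∘
★ `stratum_G1_eq` ∘ ★ LH7-p05 `finsum_labelledOdd_div_relIndex_glued_sep_eq` ∘ back through `P` (§2). [cite: Kottwitz1986BaseChangeUnits, §1 pp. 240–241] [cite: LanglandsShelstad1987, §3] -/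
theorem finsum_stratum_G3_shell_labelledOdd_div_relIndex_eq_card_mul_sum {σ : K →+* K} {ϖ : K} {d t₂ : ℕ} (hD : IsRamifiedQuadraticDatum σ ϖ d t₂)
    (h2 : Valued.v (2 : K) < 1) {s₃ : Fin 3 → K} (T : GL (Fin 3) K) (hT : (T : Matrix (Fin 3) (Fin 3) K) = Matrix.diagonal s₃)
    (ρ t : ℕ) (hρ : 1 ≤ ρ) (ht : 1 ≤ t) (R : Finset K) (hR1 : ∀ g ∈ R, σ g = g ∧ Valued.v g = Valued.v ϖ ^ (2 * t))
    (hR2 : ∀ f : K, σ f = f → Valued.v f = Valued.v ϖ ^ (2 * t) → ∃ g ∈ R, Valued.v (f - g) ≤ Valued.v ϖ ^ (ρ + 2 * t))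
    (hR3 : ∀ g ∈ R, ∀ g' ∈ R, Valued.v (g - g') ≤ Valued.v ϖ ^ (ρ + 2 * t) → g = g')
    (tv : ℕ) (i : Fin 3) {Λ : Submodule 𝒪[K] (Fin 3 → K) → (Fin 3 → K) → Prop} (hΛ : IsTorusEquivariantLabel σ Λ) (ℓ ℓ' mc : ℕ) (e e₂ : Fin 3 → K) :
    ∑ᶠ M ∈ {M : Submodule 𝒪[K] (Fin 3 → K) | M ∈ stratum σ ϖ T ![2 * ρ + 2 * t, 2 * ρ + 2 * t, 2 * ρ] ∧
        (LatticeInLevel ϖ ℓ (Matrix.diagonal e) M ∧ ¬ LatticeInLevel ϖ ℓ' (Matrix.diagonal e) M ∧ LatticeInLevel ϖ mc (Matrix.diagonal e₂) M)},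
      (labelledOddCount σ ϖ tv i Λ M : ℚ) / ((((unitStabilizer M).map (unitNormMap σ 3)).relIndex (fixedUnitTorus σ 3) : ℕ) : ℚ) =
    ((((Nat.card 𝓀[K] - 1) * Nat.card 𝓀[K] ^ (ρ + 2 * t - 1)) * ((Nat.card 𝓀[K] - 1) * Nat.card 𝓀[K] ^ (2 * ρ - 1)) : ℕ) : ℚ) *
      ∑ g ∈ R.filter (fun g =>
          mapGL T (latt (!![1, 0, 0; (1 + g)⁻¹, ϖ ^ (ρ + 2 * t), 0; (1 + g)⁻¹, -(ϖ ^ (ρ + 2 * t) * g⁻¹), ϖ ^ (2 * ρ)] : Matrix (Fin 3) (Fin 3) K)) =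
              latt (!![1, 0, 0; (1 + g)⁻¹, ϖ ^ (ρ + 2 * t), 0; (1 + g)⁻¹, -(ϖ ^ (ρ + 2 * t) * g⁻¹), ϖ ^ (2 * ρ)] : Matrix (Fin 3) (Fin 3) K) ∧
            (LatticeInLevel ϖ ℓ (Matrix.diagonal e) (latt (!![1, 0, 0; (1 + g)⁻¹, ϖ ^ (ρ + 2 * t), 0; (1 + g)⁻¹, -(ϖ ^ (ρ + 2 * t) * g⁻¹), ϖ ^ (2 * ρ)] : Matrix (Fin 3) (Fin 3) K)) ∧
              ¬ LatticeInLevel ϖ ℓ' (Matrix.diagonal e) (latt (!![1, 0, 0; (1 + g)⁻¹, ϖ ^ (ρ + 2 * t), 0; (1 + g)⁻¹, -(ϖ ^ (ρ + 2 * t) * g⁻¹), ϖ ^ (2 * ρ)] : Matrix (Fin 3) (Fin 3) K)) ∧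
              LatticeInLevel ϖ mc (Matrix.diagonal e₂) (latt (!![1, 0, 0; (1 + g)⁻¹, ϖ ^ (ρ + 2 * t), 0; (1 + g)⁻¹, -(ϖ ^ (ρ + 2 * t) * g⁻¹), ϖ ^ (2 * ρ)] : Matrix (Fin 3) (Fin 3) K)))),
        (labelledOddCount σ ϖ tv i Λ (latt (!![1, 0, 0; (1 + g)⁻¹, ϖ ^ (ρ + 2 * t), 0; (1 + g)⁻¹, -(ϖ ^ (ρ + 2 * t) * g⁻¹), ϖ ^ (2 * ρ)] : Matrix (Fin 3) (Fin 3) K)) : ℚ) /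
          ((((unitStabilizer (latt (!![1, 0, 0; (1 + g)⁻¹, ϖ ^ (ρ + 2 * t), 0; (1 + g)⁻¹, -(ϖ ^ (ρ + 2 * t) * g⁻¹), ϖ ^ (2 * ρ)] : Matrix (Fin 3) (Fin 3) K))).map
              (unitNormMap σ 3)).relIndex (fixedUnitTorus σ 3) : ℕ) : ℚ) := by
  obtain ⟨hσ, hvσ, hϖ, hfix, -, -, -⟩ := id hD
  obtain ⟨hϖ0, hϖ1⟩ := ne_zero_and_v_lt_one_of_v_eq_exp hϖ
  have hTr := trace_bound_of_isRamifiedQuadraticDatum hD h2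
  obtain ⟨P, hP⟩ := exists_gl_coe_eq_permMatrix (K := K) (Equiv.swap (0 : Fin 3) 2)
  -- step 1: the engine at `π = (0 2)`
  rw [finsum_stratum_shell_labelledOdd_div_relIndex_perm σ ϖ P hP T _ tv i Λ ℓ ℓ' mc e e₂]
  have ha : (![2 * ρ + 2 * t, 2 * ρ + 2 * t, 2 * ρ] : Fin 3 → ℕ) ∘ ⇑(Equiv.swap (0 : Fin 3) 2).symm = ![2 * ρ, 2 * ρ + 2 * t, 2 * ρ + 2 * t] := by
    ext j; fin_cases j <;> rfl
  have hT₁ : ((P⁻¹ * T * P : GL (Fin 3) K) : Matrix (Fin 3) (Fin 3) K) = Matrix.diagonal (s₃ ∘ ⇑(Equiv.swap (0 : Fin 3) 2).symm) :=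
    coe_conj_eq_diagonal P hP T hT
  -- step 2: the G₁ stratum of `P⁻¹TP` is the glued family; step 3: ★ LH7-p05's decomposition
  rw [ha, stratum_G1_eq hvσ hfix hϖ (P⁻¹ * T * P) hρ (by omega : 1 ≤ 2 * t)]
  choose V₀ hV₀ using fun g : K => exists_gl_coe_eq_glued (1 : K) 1 g (pow_ne_zero ρ hϖ0) (pow_ne_zero (2 * ρ + 2 * t) hϖ0)
  have hΛ' := isTorusEquivariantLabel_comp_mapGL_perm σ P hP hΛ
  have hcut : ∀ u ∈ unitTorus K 3, ∀ M : Submodule 𝒪[K] (Fin 3 → K),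
      (LatticeInLevel ϖ ℓ (Matrix.diagonal (e ∘ ⇑(Equiv.swap (0 : Fin 3) 2).symm)) (mapGL (diagGLUnits u) M) ∧
          ¬ LatticeInLevel ϖ ℓ' (Matrix.diagonal (e ∘ ⇑(Equiv.swap (0 : Fin 3) 2).symm)) (mapGL (diagGLUnits u) M) ∧
          LatticeInLevel ϖ mc (Matrix.diagonal (e₂ ∘ ⇑(Equiv.swap (0 : Fin 3) 2).symm)) (mapGL (diagGLUnits u) M)) ↔
        (LatticeInLevel ϖ ℓ (Matrix.diagonal (e ∘ ⇑(Equiv.swap (0 : Fin 3) 2).symm)) M ∧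
          ¬ LatticeInLevel ϖ ℓ' (Matrix.diagonal (e ∘ ⇑(Equiv.swap (0 : Fin 3) 2).symm)) M ∧
          LatticeInLevel ϖ mc (Matrix.diagonal (e₂ ∘ ⇑(Equiv.swap (0 : Fin 3) 2).symm)) M) := fun u _ M => by
    rw [latticeInLevel_diagonal_mapGL_iff (coe_diagGLUnits u), latticeInLevel_diagonal_mapGL_iff (coe_diagGLUnits u),
      latticeInLevel_diagonal_mapGL_iff (coe_diagGLUnits u)]
  rw [finsum_labelledOdd_div_relIndex_glued_sep_eq hσ hvσ hϖ hTr (P⁻¹ * T * P) hT₁ ρ t hρ ht R hR1 hR2 hR3 V₀ hV₀ tv (Equiv.swap (0 : Fin 3) 2 i) hΛ' _ hcut]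
  -- step 4: back through `P`, representative by representative
  have hrep : ∀ g ∈ R, mapGL P (latt (V₀ g : Matrix (Fin 3) (Fin 3) K)) =
      latt (!![1, 0, 0; (1 + g)⁻¹, ϖ ^ (ρ + 2 * t), 0; (1 + g)⁻¹, -(ϖ ^ (ρ + 2 * t) * g⁻¹), ϖ ^ (2 * ρ)] : Matrix (Fin 3) (Fin 3) K) :=
    fun g hg => mapGL_swap02_latt_glued_rep_eq P hP hϖ ρ t ht (hR1 g hg).2 (V₀ g) (hV₀ g)
  have hconj : P * (P⁻¹ * T * P) * P⁻¹ = T := by group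
  congr 1
  refine Finset.sum_congr ?_ fun g hg => ?_
  · ext g
    simp only [Finset.mem_filter]
    refine and_congr_right fun hgR => ?_
    rw [← hrep g hgR, ← mapGL_conj_mapGL_eq_iff P (P⁻¹ * T * P), hconj, latticeInLevel_diagonal_mapGL_perm_iff P hP ϖ ℓ e,
      latticeInLevel_diagonal_mapGL_perm_iff P hP ϖ ℓ' e, latticeInLevel_diagonal_mapGL_perm_iff P hP ϖ mc e₂]
  · rw [Finset.mem_filter] at hg
    rw [← hrep g hg.1, labelledOddCount_div_relIndex_mapGL_perm σ ϖ P hP tv i Λ]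


open Classical in
/-- **ON THE READ THE FILTER IS EVERYTHING**: element datum (`N₀ ≥ mcOfRecord d`), `T = diag(α, β, 1)`, READ `2ρ + 2t + ℓ₀ = n₃`, TUBE GUARD `2ρ + 2 + ℓ₀ ≤ min n₁ n₂` (the letters of
★ (T1) `hG3t` ∕ ★ p861354 `hbeyond`, `s = 2t`): every `M(g)` is stable (§2) and on the clean shell of record (★ p861424 `shell_of_mem_stratum_G3_of_guard`), so the sum is
`|orbit| · Σ_{g ∈ R} m^Λ_i(M(g))∕[𝒰 : N(S̃(M(g)))]`; R5b (LH7-p06 (g0)) = this ∘ the per-representative value. [cite: Kottwitz1986BaseChangeUnits, §1 pp. 240–241] [cite: LanglandsShelstad1987, §3] -/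
theorem finsum_stratum_G3_shell_labelledOdd_div_relIndex_eq_card_mul_sum_of_read {σ : K →+* K} {ϖ : K} {d t₂ : ℕ} (hD : IsRamifiedQuadraticDatum σ ϖ d t₂)
    (h2 : Valued.v (2 : K) < 1) {α β : K} {N₀ n₁ n₂ n₃ : ℕ} (hE : IsElementDatum σ ϖ N₀ α β n₁ n₂ n₃) (hmc : mcOfRecord d ≤ N₀)
    (T : GL (Fin 3) K) (hT : (T : Matrix (Fin 3) (Fin 3) K) = Matrix.diagonal ![α, β, 1])
    (ρ t : ℕ) (hρ : 1 ≤ ρ) (ht : 1 ≤ t) (hP : 2 * ρ + 2 * t + d % 2 = n₃) (hguard : 2 * ρ + 2 + d % 2 ≤ min n₁ n₂)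
    (R : Finset K) (hR1 : ∀ g ∈ R, σ g = g ∧ Valued.v g = Valued.v ϖ ^ (2 * t))
    (hR2 : ∀ f : K, σ f = f → Valued.v f = Valued.v ϖ ^ (2 * t) → ∃ g ∈ R, Valued.v (f - g) ≤ Valued.v ϖ ^ (ρ + 2 * t))
    (hR3 : ∀ g ∈ R, ∀ g' ∈ R, Valued.v (g - g') ≤ Valued.v ϖ ^ (ρ + 2 * t) → g = g')
    (tv : ℕ) (i : Fin 3) {Λ : Submodule 𝒪[K] (Fin 3 → K) → (Fin 3 → K) → Prop} (hΛ : IsTorusEquivariantLabel σ Λ) :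
    ∑ᶠ M ∈ {M : Submodule 𝒪[K] (Fin 3 → K) | M ∈ stratum σ ϖ T ![2 * ρ + 2 * t, 2 * ρ + 2 * t, 2 * ρ] ∧
        (LatticeInLevel ϖ (d % 2) (Matrix.diagonal ![α - 1, β - 1, 0]) M ∧ ¬ LatticeInLevel ϖ (d % 2 + 1) (Matrix.diagonal ![α - 1, β - 1, 0]) M ∧
          LatticeInLevel ϖ (mcOfRecord d) (Matrix.diagonal ![(α - 1) * (α - 1), (β - 1) * (β - 1), 0]) M)},
      (labelledOddCount σ ϖ tv i Λ M : ℚ) / ((((unitStabilizer M).map (unitNormMap σ 3)).relIndex (fixedUnitTorus σ 3) : ℕ) : ℚ) =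
    ((((Nat.card 𝓀[K] - 1) * Nat.card 𝓀[K] ^ (ρ + 2 * t - 1)) * ((Nat.card 𝓀[K] - 1) * Nat.card 𝓀[K] ^ (2 * ρ - 1)) : ℕ) : ℚ) *
      ∑ g ∈ R,
        (labelledOddCount σ ϖ tv i Λ (latt (!![1, 0, 0; (1 + g)⁻¹, ϖ ^ (ρ + 2 * t), 0; (1 + g)⁻¹, -(ϖ ^ (ρ + 2 * t) * g⁻¹), ϖ ^ (2 * ρ)] : Matrix (Fin 3) (Fin 3) K)) : ℚ) /
          ((((unitStabilizer (latt (!![1, 0, 0; (1 + g)⁻¹, ϖ ^ (ρ + 2 * t), 0; (1 + g)⁻¹, -(ϖ ^ (ρ + 2 * t) * g⁻¹), ϖ ^ (2 * ρ)] : Matrix (Fin 3) (Fin 3) K))).map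
              (unitNormMap σ 3)).relIndex (fixedUnitTorus σ 3) : ℕ) : ℚ) := by
  obtain ⟨-, hvσ, hϖ, -, -, -, -⟩ := id hD
  have hρ₁ : 2 * ρ + 2 * t ≤ n₃ := by omega
  have hρ₂ : 2 * ρ ≤ n₂ := le_trans (by omega) (hguard.trans (min_le_right _ _))
  have hρ₃ : ρ ≤ n₁ := le_trans (by omega) (hguard.trans (min_le_left _ _))
  rw [finsum_stratum_G3_shell_labelledOdd_div_relIndex_eq_card_mul_sum hD h2 T hT ρ t hρ ht R hR1 hR2 hR3 tv i hΛ]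
  congr 1
  refine Finset.sum_congr (Finset.filter_true_of_mem fun g hg => ?_) fun _ _ => rfl
  have hst := mapGL_latt_G3_rep_of_depths hvσ hϖ hE T hT ht hρ₁ hρ₂ hρ₃ (hR1 g hg).2
  exact ⟨hst, shell_of_mem_stratum_G3_of_guard hD hE hmc T ρ (2 * t) hρ (by omega) hguard hP
    (latt_G3_rep_mem_stratum_of_depths hD hE T hT hρ ht hρ₁ hρ₂ hρ₃ (hR1 g hg).1 (hR1 g hg).2)⟩

end Head

end Summit.HodgeConjecture.HodgeConjecture.Cruxes.H413.F0P3cDyRamLabelledOddG3OrbitDecomposition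

end
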